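import Literature.Analysis.Complex.RiemannExtension
import Literature.Analysis.Complex.PolynomialGrowthLiouvilleSCV
import Literature.Analysis.Complex.BranchedCoveringCharPolySCV
import Mathlib.Analysis.SpecialFunctions.Complex.LogDeriv
import Mathlib.Algebra.MvPolynomial.Funext
import Mathlib.RingTheory.RootsOfUnity.PrimitiveRoots
import Mathlib.RingTheory.RootsOfUnity.Complex

/-!
# Programme PG-FERMAT, brick F3 (part 1/3): local holomorphic roots and the polynomial bookkeeping

Prover seat `hodge-nonav-prover-Bx` (g10), cell `hodge-nonav`, programme PG-FERMAT (memo `PROGRAMME-PG-FERMAT-Bx-g10.md`, evidence #48 on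
stmt-HodgeConjecture-19544): after `CyclicUnitaryPowersK1OfFermatGenusLe` the binder PG of crux K1-A `VeryGeneralDeckCommutatorsInHg` (route
`HodgeConjecture/CyclicUnitaryPowers`) is reduced to `h^{2,0}(X²_p) ≤ C(p−1,3)` for the Fermat surface of prime degree `p ≥ 5`, i.e. to the vanishing
of the holomorphic `2`-forms in the `μ_p⁴`-eigenlines with `|α| = 2`; on the affine piece these are `g · Res(x₃^{p−4}Ω/F)` with `g` a holomorphic
`μ_p³`-eigenfunction of polynomial growth on the affine Fermat surface `U = {y ∈ ℂ³ : y₀^p + y₁^p + y₂^p = −1}`. The three files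
`CyclicUnitaryPowersFermatAffineEigenfunctions{Roots,Descent,}` prove the purely ANALYTIC statement (no Hodge theory, no schemes; Mathlib + the
tree's several-complex-variables library `Literature/Analysis/Complex/{RiemannExtension, PolynomialGrowthLiouvilleSCV, BranchedCoveringCharPolySCV}`).
Sources of the method: J.-P. Serre, GAGA (1956) n° 19–20; L. Hörmander (1973) Thm. 2.2.7; T. Shioda, Math. Ann. 245 (1979) §1.
Sorry-free; no definition, no named fact; helper (`--supports … --as helper`); nothing here says HC ∕ HC_AV is proved.

* `exists_local_root` — a local holomorphic `p`-th root near `w₀ ≠ 0` (`r₀ e^{log(w/w₀)/p}`).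
* `coeff_aeval_scale`, `eval_aeval_scale` — the scaling substitution `Xᵢ ↦ sᵢ Xᵢ` on coefficients and values.
* `dvd_of_coeff_ne_zero_of_invariant` — invariance of the polynomial function under `yᵢ ↦ ζ yᵢ` (`ζ` a primitive `p`-th root of unity)
  forces `p ∣ dᵢ` on the support; `coeff_eq_zero_of_eval_zero` — vanishing on `{yᵢ = 0}` forces `Xᵢ` in every monomial.
-/

noncomputable section

set_option linter.dupNamespace false

open Complex Set Filter Metric Function
open scoped Topology

namespace Summit.HodgeConjecture.HodgeConjecture.Theorems.CyclicUnitaryPowersFermatAffineEigenfunctions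

open Literature.Analysis.Complex

/-! ### §0 Local holomorphic `p`-th roots -/

/-- **A local holomorphic `p`-th root**: for `w₀ ≠ 0` and `r₀^p = w₀` (`p ≥ 1`) there is an open `V ∋ w₀` and `ρ` holomorphic on `V`
with `ρ(w₀) = r₀` and `ρ(w)^p = w` on `V` — namely `ρ(w) = r₀ · exp(log(w/w₀)/p)` on `V = {w : w/w₀ ∈ ℂ ∖ (−∞,0]}`. -/
theorem exists_local_root {p : ℕ} (hp : 1 ≤ p) {w₀ r₀ : ℂ} (hw₀ : w₀ ≠ 0) (hr : r₀ ^ p = w₀) :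
    ∃ V : Set ℂ, IsOpen V ∧ w₀ ∈ V ∧ ∃ ρ : ℂ → ℂ, DifferentiableOn ℂ ρ V ∧ ρ w₀ = r₀ ∧ ∀ w ∈ V, ρ w ^ p = w := by
  refine ⟨{w | w / w₀ ∈ slitPlane}, ?_, ?_, fun w ↦ r₀ * exp (log (w / w₀) / p), ?_, ?_, ?_⟩
  · exact isOpen_slitPlane.preimage (continuous_id.div_const w₀)
  · show w₀ / w₀ ∈ slitPlane
    rw [div_self hw₀]
    exact one_mem_slitPlane
  · intro w hw
    refine DifferentiableAt.differentiableWithinAt ?_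
    refine (differentiableAt_const _).mul ?_
    refine DifferentiableAt.cexp ?_
    refine DifferentiableAt.div_const ?_ _
    exact (differentiableAt_id.div_const w₀).clog hw
  · simp [div_self hw₀]
  · intro w hw
    have hw0 : w / w₀ ≠ 0 := slitPlane_ne_zero hw
    have hp0 : (p : ℂ) ≠ 0 := Nat.cast_ne_zero.mpr (by omega)
    rw [mul_pow, hr, ← exp_nat_mul, mul_div_cancel₀ _ hp0, exp_log hw0, mul_div_cancel₀ _ hw₀]

/-! ### §1 Polynomial bookkeeping on `ℂ[X₀, X₁]` -/

section Poly

variable {σ : Type*} [Fintype σ] [DecidableEq σ]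

/-- The scaling substitution `Xᵢ ↦ sᵢ Xᵢ` multiplies the coefficient of `X^d` by `∏ sᵢ^{dᵢ}`. -/
theorem coeff_aeval_scale (s : σ → ℂ) (P : MvPolynomial σ ℂ) (d : σ →₀ ℕ) :
    MvPolynomial.coeff d (MvPolynomial.aeval (fun i ↦ MvPolynomial.C (s i) * MvPolynomial.X i) P) =
      (∏ i, s i ^ d i) * MvPolynomial.coeff d P := by
  induction P using MvPolynomial.induction_on' with
  | monomial c r =>
    rw [MvPolynomial.aeval_monomial, MvPolynomial.algebraMap_eq]
    have : (Finsupp.prod c fun i k ↦ (MvPolynomial.C (s i) * MvPolynomial.X i) ^ k) =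
        MvPolynomial.C (∏ i, s i ^ c i) * MvPolynomial.monomial c 1 := by
      rw [Finsupp.prod_fintype _ _ (fun i ↦ by rw [pow_zero]), MvPolynomial.monomial_eq, MvPolynomial.C_1, one_mul,
        Finsupp.prod_fintype _ _ (fun i ↦ by rw [pow_zero]), map_prod, ← Finset.prod_mul_distrib]
      refine Finset.prod_congr rfl fun i _ ↦ ?_
      rw [mul_pow, map_pow]
    rw [this, ← mul_assoc, ← map_mul, MvPolynomial.coeff_C_mul, MvPolynomial.coeff_monomial, MvPolynomial.coeff_monomial]
    split_ifs with h
    · subst h; ring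
    · simp
  | add p q hp hq => rw [map_add, MvPolynomial.coeff_add, MvPolynomial.coeff_add, hp, hq, mul_add]

omit [Fintype σ] [DecidableEq σ] in
/-- The scaling substitution evaluates as `eval a (P(s • X)) = eval (s • a) P`. -/
theorem eval_aeval_scale (s a : σ → ℂ) (P : MvPolynomial σ ℂ) :
    MvPolynomial.eval a (MvPolynomial.aeval (fun i ↦ MvPolynomial.C (s i) * MvPolynomial.X i) P) =
      MvPolynomial.eval (fun i ↦ s i * a i) P := by
  rw [show MvPolynomial.aeval (fun i ↦ MvPolynomial.C (s i) * MvPolynomial.X i) P =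
      MvPolynomial.eval₂ MvPolynomial.C (fun i ↦ MvPolynomial.C (s i) * MvPolynomial.X i) P from rfl,
    MvPolynomial.eval_eval₂]
  · congr 1
    · ext r; simp
    · funext i; simp

/-- **Invariance under `yᵢ ↦ ζ yᵢ` forces `p ∣ dᵢ` on the support**: if the polynomial function `P` on `ℂ^σ` is invariant under scaling
the `i`-th coordinate by a primitive `p`-th root of unity `ζ`, then every exponent vector `d` with `coeff d P ≠ 0` has `p ∣ d i`. -/
theorem dvd_of_coeff_ne_zero_of_invariant {p : ℕ} {ζ : ℂ} (hζ : IsPrimitiveRoot ζ p) (i : σ) (P : MvPolynomial σ ℂ)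
    (hinv : ∀ a : σ → ℂ, MvPolynomial.eval (Function.update a i (ζ * a i)) P = MvPolynomial.eval a P)
    {d : σ →₀ ℕ} (hd : MvPolynomial.coeff d P ≠ 0) : p ∣ d i := by
  classical
  set s : σ → ℂ := Function.update (fun _ ↦ (1 : ℂ)) i ζ with hs
  have hQ : MvPolynomial.aeval (fun j ↦ MvPolynomial.C (s j) * MvPolynomial.X j) P = P := by
    refine MvPolynomial.funext fun a ↦ ?_
    rw [eval_aeval_scale]
    have : (fun j ↦ s j * a j) = Function.update a i (ζ * a i) := by
      funext j
      by_cases hj : j = i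
      · subst hj; simp [hs]
      · simp [hs, Function.update_of_ne hj]
    rw [this, hinv]
  have hc := coeff_aeval_scale s P d
  rw [hQ] at hc
  have hprod : (∏ j, s j ^ d j) = ζ ^ d i := by
    rw [← Finset.prod_erase_mul _ _ (Finset.mem_univ i)]
    rw [show s i = ζ by simp [hs], Finset.prod_eq_one fun j hj ↦ ?_, one_mul]
    rw [Finset.mem_erase] at hj
    simp [hs, Function.update_of_ne hj.1]
  rw [hprod] at hc
  have h1 : ζ ^ d i = 1 := by
    have := mul_right_cancel₀ hd (hc.symm.trans (one_mul _).symm)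
    exact this
  exact (hζ.pow_eq_one_iff_dvd (d i)).mp h1

/-- **If `P` vanishes whenever the `i`-th coordinate does, every monomial of `P` contains `Xᵢ`**: `coeff d P = 0` for `d i = 0`. -/
theorem coeff_eq_zero_of_eval_zero (i : σ) (P : MvPolynomial σ ℂ)
    (h0 : ∀ a : σ → ℂ, a i = 0 → MvPolynomial.eval a P = 0) {d : σ →₀ ℕ} (hd : d i = 0) :
    MvPolynomial.coeff d P = 0 := by
  classical
  -- the substitution `Xᵢ ↦ 0`
  set s : σ → ℂ := Function.update (fun _ ↦ (1 : ℂ)) i 0 with hs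
  have hQ : MvPolynomial.aeval (fun j ↦ MvPolynomial.C (s j) * MvPolynomial.X j) P = 0 := by
    refine MvPolynomial.funext fun a ↦ ?_
    rw [eval_aeval_scale, map_zero]
    exact h0 _ (by simp [hs])
  have hc := coeff_aeval_scale s P d
  rw [hQ, MvPolynomial.coeff_zero] at hc
  have hprod : (∏ j, s j ^ d j) = 1 := by
    refine Finset.prod_eq_one fun j _ ↦ ?_
    by_cases hj : j = i
    · subst hj; rw [hd, pow_zero]
    · simp [hs, Function.update_of_ne hj]
  rw [hprod, one_mul] at hc
  exact hc.symm

end Poly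
end Summit.HodgeConjecture.HodgeConjecture.Theorems.CyclicUnitaryPowersFermatAffineEigenfunctions

end
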